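import Summits.AtomisticToContinuum.Crystallization.Theorems.ChargedEnergyGapOrthoVolume
import HarnessLib

/-!
# Charged energy gap — lens-3 g64, node «BarlowRef» (R3) — part 14 (addendum; imports part 13 `…OrthoVolume`, land after it): SPHERICAL CAPS by stepped cylinders and the CORED SOURCE COUNT

The last container formula of the certified `TubeShareBoundH` numerator (HANDOFF g65 item 2 (S)): the cumulative CORED source counts
`#{y ∈ F : dist y c ≤ A}` for sources `y` with `ϱ ≤ dist y x₀` around a member `c` with `dist x₀ c = L < ϱ`.  By part 13 the count is bounded by the
volume of the `9/5`-neighbourhood of the cored region `B̄(c, A) ∖ B(x₀, ϱ)`; here that neighbourhood is placed inside a SPHERICAL CAP of `B̄(c, A + 9/5)`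
(axis `x₀ → c`, the half-space lemma of part 8 in the new currency) and the cap's volume is bounded by STEPPED CYLINDERS (part 13 `volume_orthoCylinder`)
on any grid (cheap) AND exactly, by one Fubini integration plus the exact lens geometry (the two caps cut by the plane of the intersection circle):

* `orthoCap b c t ρ := {x | t ≤ ⟪b 2, x − c⟫ ∧ dist x c ≤ ρ}`; `cap_slice_subset_cylinder`; `exists_grid_step`; ★ `volume_orthoCap_le_steps`
  (`volume (orthoCap b c (t 0) ρ) ≤ Σ_{i<k} (t(i+1) − t i) · π (ρ² − (max (t i) 0)²)` for any grid with `ρ ≤ t k` — the cheap, integration-free bound);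
* ★ `near_cored_subset_cap` — with `b 2 = (dist x₀ c)⁻¹ • (c − x₀)`, `0 < L = dist x₀ c`, `D ≤ ϱ`:
  `{x | ∃ z, (dist z c ≤ A ∧ ϱ ≤ dist z x₀) ∧ dist x z ≤ D} ⊆ orthoCap b c (((ϱ − D)² − L² − (A + D)²)/(2L)) (A + D)`;
* `card_mul_le_capSteps_of_cored` — the stepped count;
* ★★ `volume_orthoCap_eq` — THE EXACT CAP VOLUME `volume (orthoCap b c t ρ) = capVol ρ t := (π/3)(ρ − t)²(2ρ + t)` for `−ρ ≤ t ≤ ρ`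
  (one Fubini integration: `Measure.prod_apply` over the axial coordinate, disc slices `volume_coordDisc`, `ofReal_integral_eq_lintegral_ofReal`,
  `integral_cap_profile` = `intervalIntegral.integral_const` + `integral_pow`); `measurableSet_orthoCap`;
* ★★ `innerCap_subset_cap` + `volume_coredCap_le` — EXACT LENS GEOMETRY: with the plane level `t = (ϱ'² − L² − A'²)/(2L)` the cap of `B̄(x₀, ϱ')` above
  the plane lies inside the cap of `B̄(c, A')` and misses the cored part, so `volume (orthoCap b c t A' ∩ {ϱ' ≤ dist · x₀}) ≤ capVol A' t − capVol ϱ' (t + L)`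
  (the bounding sphere is null: `Measure.addHaar_sphere`) — this is the exact volume of `B̄(c, A') ∖ B(x₀, ϱ')`;
* ★★ `card_mul_le_capDiff_of_cored` — THE EXACT CORED SOURCE COUNT: finite `T ⊆ g '' barlowStacking a h s` with `dist y c ≤ A`, `ϱ ≤ dist y x₀` on `T`
  ⟹ `#T · a(a√3/2)h ≤ capVol (A + 9/5) t − capVol (ϱ − 9/5) (t + L)`, `t = ((ϱ − 9/5)² − L² − (A + 9/5)²)/(2L)`, in the range
  `−(A + 9/5) ≤ t ≤ A + 9/5`, `−(ϱ − 9/5) ≤ t + L ≤ ϱ − 9/5` (outside it the region is a whole ball or empty: use part 12).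
  This is cert64's «SRC=BU» column as a theorem shape: no meniscus loss, no stepping loss.

0 sorry; standard axioms.
-/

noncomputable section

open scoped Classical RealInnerProductSpace ENNReal
open MeasureTheory
open Literature.MathematicalPhysics.StatisticalMechanics Literature.Geometry.DiscreteGeometry
open Summit.AtomisticToContinuum.Crystallization.Theses.PricedLinkCensus
open Summit.AtomisticToContinuum.Crystallization.Theorems.ChargedEnergyGapNegative

namespace Summit.AtomisticToContinuum.Crystallization.Theorems.ChargedEnergyGapChartDial

section CapCount

/-- The spherical cap of `B̄(c, ρ)` beyond axial level `t` (axis `b 2`). -/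
def orthoCap (b : OrthonormalBasis (Fin 3) ℝ E3) (c : E3) (t ρ : ℝ) : Set E3 :=
  {x | t ≤ ⟪b 2, x - c⟫ ∧ dist x c ≤ ρ}

/-- A slice `α ≤ axial ≤ β` of the cap lies in the cylinder of radius `√(ρ² − (max α 0)²)`. -/
theorem cap_slice_subset_cylinder (b : OrthonormalBasis (Fin 3) ℝ E3) (c : E3) (α β ρ : ℝ) :
    {x : E3 | α ≤ ⟪b 2, x - c⟫ ∧ ⟪b 2, x - c⟫ ≤ β ∧ dist x c ≤ ρ} ⊆ orthoCylinder b c α β (Real.sqrt (ρ ^ 2 - max α 0 ^ 2)) := by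
  rintro x ⟨h1, h2, h3⟩
  rw [mem_orthoCylinder_iff]
  refine ⟨h1, h2, ?_⟩
  have hn2 : ‖b 2‖ = 1 := b.orthonormal.1 2
  have hax : |⟪b 2, x - c⟫| ≤ dist x c := by
    calc |⟪b 2, x - c⟫| ≤ ‖b 2‖ * ‖x - c‖ := abs_real_inner_le_norm _ _
      _ = dist x c := by rw [hn2, one_mul, dist_eq_norm]
  have hρ : 0 ≤ ρ := dist_nonneg.trans h3
  have hm0 : 0 ≤ max α 0 := le_max_right _ _
  have hm1 : max α 0 ≤ |⟪b 2, x - c⟫| := max_le (h1.trans (le_abs_self _)) (abs_nonneg _)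
  have hm2 : max α 0 ^ 2 ≤ ⟪b 2, x - c⟫ ^ 2 := by
    rw [← sq_abs ⟪b 2, x - c⟫]; exact pow_le_pow_left₀ hm0 hm1 2
  have hmρ : max α 0 ^ 2 ≤ ρ ^ 2 := pow_le_pow_left₀ hm0 (hm1.trans (hax.trans h3)) 2
  have hpar := inner_sq_add_inner_sq_eq b (x - c)
  have hd : ‖x - c‖ ^ 2 ≤ ρ ^ 2 := by rw [← dist_eq_norm]; exact pow_le_pow_left₀ dist_nonneg h3 2
  rw [Real.sq_sqrt (by linarith)]
  linarith

/-- Grid location: for a monotone grid `t` with `t 0 ≤ u ≤ t k`, `0 < k`, some step `[t i, t (i+1)]`, `i < k`, contains `u`. -/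
theorem exists_grid_step (t : ℕ → ℝ) {u : ℝ} {k : ℕ} (hk : 0 < k) (h0 : t 0 ≤ u) (hu : u ≤ t k) :
    ∃ i < k, t i ≤ u ∧ u ≤ t (i + 1) := by
  induction k with
  | zero => exact absurd hk (lt_irrefl 0)
  | succ n ih =>
    by_cases hn : u ≤ t n
    · rcases Nat.eq_zero_or_pos n with rfl | hpos
      · exact ⟨0, Nat.succ_pos 0, h0, hu⟩
      · obtain ⟨i, hi, h1, h2⟩ := ih hpos hn
        exact ⟨i, Nat.lt_succ_of_lt hi, h1, h2⟩
    · rw [not_le] at hn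
      exact ⟨n, Nat.lt_succ_self n, hn.le, hu⟩

/-- ★ CAP VOLUME BY STEPPED CYLINDERS: for any grid `t : ℕ → ℝ` with `ρ ≤ t k`, `0 < k` (non-monotone steps contribute `0`):
`volume (orthoCap b c (t 0) ρ) ≤ Σ_{i<k} (t(i+1) − t i) · (ρ² − (max (t i) 0)²) · π` (in `ℝ≥0∞`). -/
theorem volume_orthoCap_le_steps (b : OrthonormalBasis (Fin 3) ℝ E3) (c : E3) {ρ : ℝ} (t : ℕ → ℝ) {k : ℕ} (hk : 0 < k)
    (hρk : ρ ≤ t k) :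
    volume (orthoCap b c (t 0) ρ) ≤
      ∑ i ∈ Finset.range k, ENNReal.ofReal (t (i + 1) - t i) * (ENNReal.ofReal (ρ ^ 2 - max (t i) 0 ^ 2) * ENNReal.ofReal Real.pi) := by
  have hcover : orthoCap b c (t 0) ρ ⊆ ⋃ i ∈ Finset.range k, orthoCylinder b c (t i) (t (i + 1)) (Real.sqrt (ρ ^ 2 - max (t i) 0 ^ 2)) := by
    rintro x ⟨h1, h2⟩
    have hn2 : ‖b 2‖ = 1 := b.orthonormal.1 2
    have hax : ⟪b 2, x - c⟫ ≤ ρ := by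
      calc ⟪b 2, x - c⟫ ≤ |⟪b 2, x - c⟫| := le_abs_self _
        _ ≤ ‖b 2‖ * ‖x - c‖ := abs_real_inner_le_norm _ _
        _ = dist x c := by rw [hn2, one_mul, dist_eq_norm]
        _ ≤ ρ := h2
    obtain ⟨i, hi, hi1, hi2⟩ := exists_grid_step t hk h1 (hax.trans hρk)
    refine Set.mem_iUnion₂.2 ⟨i, Finset.mem_range.2 hi, ?_⟩
    exact cap_slice_subset_cylinder b c (t i) (t (i + 1)) ρ ⟨hi1, hi2, h2⟩
  refine (measure_mono hcover).trans ((measure_biUnion_finset_le _ _).trans (Finset.sum_le_sum fun i _ => ?_))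
  have hs : 0 ≤ Real.sqrt (ρ ^ 2 - max (t i) 0 ^ 2) := Real.sqrt_nonneg _
  rw [volume_orthoCylinder b c hs, ← ENNReal.ofReal_pow hs]
  rcases le_or_gt 0 (ρ ^ 2 - max (t i) 0 ^ 2) with hnn | hneg
  · rw [Real.sq_sqrt hnn]
  · rw [Real.sqrt_eq_zero'.2 hneg.le, ENNReal.ofReal_of_nonpos hneg.le]
    simp

/-- ★ THE CORED NEIGHBOURHOOD LIES IN A CAP (part 8's half-space lemma in the new currency): member `c` at distance `L = dist x₀ c > 0` from the core
point `x₀`, axis `b 2 = L⁻¹ • (c − x₀)`; points within `D` (`D ≤ ϱ`) of a source `z` with `dist z c ≤ A`, `ϱ ≤ dist z x₀` lie in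
`orthoCap b c (((ϱ − D)² − L² − (A + D)²) / (2L)) (A + D)`. -/
theorem near_cored_subset_cap {b : OrthonormalBasis (Fin 3) ℝ E3} {x₀ c : E3} {A ϱ D : ℝ} (hL : 0 < dist x₀ c)
    (hb : b 2 = (dist x₀ c)⁻¹ • (c - x₀)) (hDϱ : D ≤ ϱ) :
    {x : E3 | ∃ z, (dist z c ≤ A ∧ ϱ ≤ dist z x₀) ∧ dist x z ≤ D} ⊆
      orthoCap b c (((ϱ - D) ^ 2 - dist x₀ c ^ 2 - (A + D) ^ 2) / (2 * dist x₀ c)) (A + D) := by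
  rintro x ⟨z, ⟨hzA, hzϱ⟩, hxz⟩
  set L := dist x₀ c with hLdef
  have hxc : dist x c ≤ A + D := by
    calc dist x c ≤ dist x z + dist z c := dist_triangle _ _ _
      _ ≤ D + A := add_le_add hxz hzA
      _ = A + D := add_comm _ _
  have hxx₀ : ϱ - D ≤ dist x x₀ := by
    have := dist_triangle z x x₀
    rw [dist_comm z x] at this
    linarith
  refine ⟨?_, hxc⟩
  -- axial coordinate: 2L ⟪b 2, x − c⟫ = 2⟪x − c, c − x₀⟫ = ‖x − x₀‖² − ‖x − c‖² − L²
  have hax : ⟪b 2, x - c⟫ = ⟪x - c, c - x₀⟫ / L := by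
    rw [hb, real_inner_smul_left, real_inner_comm, div_eq_inv_mul]
  have hexp : dist x x₀ ^ 2 = dist x c ^ 2 + 2 * ⟪x - c, c - x₀⟫ + L ^ 2 := by
    have e : x - x₀ = (x - c) + (c - x₀) := by abel
    rw [dist_eq_norm, dist_eq_norm, hLdef, dist_eq_norm', e, norm_add_sq_real]
  have h1 : (ϱ - D) ^ 2 ≤ dist x x₀ ^ 2 := pow_le_pow_left₀ (by linarith) hxx₀ 2
  have h2 : dist x c ^ 2 ≤ (A + D) ^ 2 := pow_le_pow_left₀ dist_nonneg hxc 2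
  rw [hax, ← mul_div_mul_left ⟪x - c, c - x₀⟫ L (two_ne_zero)]
  exact div_le_div_of_nonneg_right (by nlinarith) (by linarith)

/-- ★★ THE CORED SOURCE COUNT BY STEPPED CAPS: window `(a,h)`, `g` isometry, member `c` with `0 < L = dist x₀ c`, axis basis `b` with `b 2 = L⁻¹ • (c − x₀)`,
`9/5 ≤ ϱ`; finite `T ⊆ g '' barlowStacking a h s` with `dist y c ≤ A` and `ϱ ≤ dist y x₀` for `y ∈ T`; a monotone grid `t : ℕ → ℝ` with
`t 0 = ((ϱ − 9/5)² − L² − (A + 9/5)²)/(2L)` and `A + 9/5 ≤ t k`, `0 < k`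
⟹ `#T · a(a√3/2)h ≤ Σ_{i<k} (t(i+1) − t i) · ((A + 9/5)² − (max (t i) 0)²) · π`. -/
theorem card_mul_le_capSteps_of_cored {a h : ℝ} {s : ℤ → ℤ} {g : E3 → E3}
    (ha : 9 / 10 ≤ a ∧ a ≤ 11 / 10) (hh : 0 < h ∧ 27 / 50 * a ^ 2 ≤ h ^ 2 ∧ h ^ 2 ≤ 121 / 150 * a ^ 2) (hg : Isometry g)
    {b : OrthonormalBasis (Fin 3) ℝ E3} {x₀ c : E3} {A ϱ : ℝ} (hL : 0 < dist x₀ c) (hb : b 2 = (dist x₀ c)⁻¹ • (c - x₀)) (hϱ : 9 / 5 ≤ ϱ)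
    (T : Finset E3) (hT : ↑T ⊆ g '' barlowStacking a h s) (hTA : ∀ y ∈ T, dist y c ≤ A) (hTϱ : ∀ y ∈ T, ϱ ≤ dist y x₀)
    (t : ℕ → ℝ) (ht : Monotone t) (ht0 : t 0 = ((ϱ - 9 / 5) ^ 2 - dist x₀ c ^ 2 - (A + 9 / 5) ^ 2) / (2 * dist x₀ c)) {k : ℕ} (hk : 0 < k)
    (htk : A + 9 / 5 ≤ t k) (hstep : ∀ i < k, max (t i) 0 ^ 2 ≤ (A + 9 / 5) ^ 2) :
    (T.card : ℝ) * (a * (a * √3 / 2) * h) ≤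
      ∑ i ∈ Finset.range k, (t (i + 1) - t i) * (((A + 9 / 5) ^ 2 - max (t i) 0 ^ 2) * Real.pi) := by
  have ha0 : 0 ≤ a := by linarith [ha.1]
  have hV0 : 0 ≤ a * (a * √3 / 2) * h := by have := hh.1.le; positivity
  set K : Set E3 := {z | dist z c ≤ A ∧ ϱ ≤ dist z x₀} with hK
  have hT' : ↑T ⊆ g '' barlowStacking a h s ∩ K := fun y hy => ⟨hT hy, hTA y (Finset.mem_coe.1 hy), hTϱ y (Finset.mem_coe.1 hy)⟩
  have h1 := card_mul_le_volume_near_of_subset_image ha hh hg K T hT'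
  have h2 : {x : E3 | ∃ z ∈ K, dist x z ≤ 9 / 5} ⊆ orthoCap b c (t 0) (A + 9 / 5) := by
    rw [ht0]
    rintro x ⟨z, hz, hxz⟩
    exact near_cored_subset_cap hL hb hϱ ⟨z, hz, hxz⟩
  have h3 := (h1.trans (measure_mono h2)).trans (volume_orthoCap_le_steps b c t hk htk)
  -- convert to ℝ
  have hterm : ∀ i ∈ Finset.range k, ENNReal.ofReal (t (i + 1) - t i) * (ENNReal.ofReal ((A + 9 / 5) ^ 2 - max (t i) 0 ^ 2) * ENNReal.ofReal Real.pi)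
      = ENNReal.ofReal ((t (i + 1) - t i) * (((A + 9 / 5) ^ 2 - max (t i) 0 ^ 2) * Real.pi)) := by
    intro i hi
    have hi' := hstep i (Finset.mem_range.1 hi)
    rw [← ENNReal.ofReal_mul (by linarith), ← ENNReal.ofReal_mul (ht (Nat.le_succ i) |> sub_nonneg.2)]
  rw [Finset.sum_congr rfl hterm, ← ENNReal.ofReal_sum_of_nonneg, ← ENNReal.ofReal_natCast, ← ENNReal.ofReal_mul (Nat.cast_nonneg _),
    ENNReal.ofReal_le_ofReal_iff] at h3
  · exact h3
  · exact Finset.sum_nonneg fun i hi => mul_nonneg (sub_nonneg.2 (ht (Nat.le_succ i)))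
      (mul_nonneg (by linarith [hstep i (Finset.mem_range.1 hi)]) Real.pi_pos.le)
  · exact fun i hi => mul_nonneg (sub_nonneg.2 (ht (Nat.le_succ i)))
      (mul_nonneg (by linarith [hstep i (Finset.mem_range.1 hi)]) Real.pi_pos.le)

/-! ## The EXACT cap volume (one Fubini integration) and the exact cored-cap difference -/

/-- Volume of the coordinate disc `{p : Fin 2 → ℝ | p 0² + p 1² ≤ σ²}` (`σ ≥ 0`). -/
theorem volume_coordDisc {σ : ℝ} (hσ : 0 ≤ σ) :
    volume {p : Fin 2 → ℝ | p 0 ^ 2 + p 1 ^ 2 ≤ σ ^ 2} = ENNReal.ofReal σ ^ 2 * ENNReal.ofReal Real.pi := by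
  have hDm : MeasurableSet {p : Fin 2 → ℝ | p 0 ^ 2 + p 1 ^ 2 ≤ σ ^ 2} :=
    measurableSet_le (((measurable_pi_apply 0).pow_const 2).add ((measurable_pi_apply 1).pow_const 2)) measurable_const
  have hpre : (WithLp.ofLp : EuclideanSpace ℝ (Fin 2) → (Fin 2 → ℝ)) ⁻¹' {p : Fin 2 → ℝ | p 0 ^ 2 + p 1 ^ 2 ≤ σ ^ 2} =
      Metric.closedBall (0 : EuclideanSpace ℝ (Fin 2)) σ := by
    ext q
    simp only [Set.mem_preimage, Set.mem_setOf_eq, Metric.mem_closedBall, dist_zero_right]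
    rw [EuclideanSpace.norm_eq, Fin.sum_univ_two, Real.sqrt_le_left hσ]
    simp only [Real.norm_eq_abs, sq_abs]
  rw [← (PiLp.volume_preserving_ofLp (Fin 2)).measure_preimage hDm.nullMeasurableSet, hpre, EuclideanSpace.volume_closedBall_fin_two]

/-- The cap-volume polynomial: `capVol ρ t = (π/3) (ρ − t)² (2ρ + t)` — the volume of `{t ≤ axial} ∩ B̄(ρ)` for `−ρ ≤ t ≤ ρ`. -/
def capVol (ρ t : ℝ) : ℝ := Real.pi / 3 * ((ρ - t) ^ 2 * (2 * ρ + t))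

/-- `capVol ρ t ≥ 0` whenever `−2ρ ≤ t`. -/
theorem capVol_nonneg {ρ t : ℝ} (h : -(2 * ρ) ≤ t) : 0 ≤ capVol ρ t := by
  unfold capVol
  have : 0 ≤ 2 * ρ + t := by linarith
  positivity

/-- The cap profile integral: `∫_t^ρ (ρ² − τ²) π dτ = capVol ρ t`. -/
theorem integral_cap_profile (t ρ : ℝ) : ∫ x in t..ρ, (ρ ^ 2 - x ^ 2) * Real.pi = capVol ρ t := by
  have h : ∫ x in t..ρ, (ρ ^ 2 - x ^ 2) * Real.pi = ((ρ - t) * ρ ^ 2 - (ρ ^ 3 - t ^ 3) / 3) * Real.pi := by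
    rw [intervalIntegral.integral_mul_const, intervalIntegral.integral_sub, intervalIntegral.integral_const, integral_pow]
    · simp only [smul_eq_mul]
      norm_num
    · exact intervalIntegrable_const
    · exact (continuous_pow 2).intervalIntegrable _ _
  rw [h, capVol]
  ring

/-- The cap in product coordinates `(axial, planar) ∈ ℝ × (Fin 2 → ℝ)`: `volume {t ≤ τ, p 0² + p 1² + τ² ≤ ρ²} = capVol ρ t` for `−ρ ≤ t ≤ ρ`
(Fubini: `Measure.prod_apply`, disc slices, `ofReal_integral_eq_lintegral_ofReal`, the profile integral). -/
theorem volume_capCoord {t ρ : ℝ} (ht : -ρ ≤ t) (htρ : t ≤ ρ) :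
    volume {z : ℝ × (Fin 2 → ℝ) | t ≤ z.1 ∧ z.2 0 ^ 2 + z.2 1 ^ 2 + z.1 ^ 2 ≤ ρ ^ 2} = ENNReal.ofReal (capVol ρ t) := by
  have hρ : 0 ≤ ρ := by linarith
  set S := {z : ℝ × (Fin 2 → ℝ) | t ≤ z.1 ∧ z.2 0 ^ 2 + z.2 1 ^ 2 + z.1 ^ 2 ≤ ρ ^ 2} with hSdef
  have hSm : MeasurableSet S := by
    have e : S = {z : ℝ × (Fin 2 → ℝ) | t ≤ z.1} ∩ {z | z.2 0 ^ 2 + z.2 1 ^ 2 + z.1 ^ 2 ≤ ρ ^ 2} := by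
      ext z; simp only [hSdef, Set.mem_setOf_eq, Set.mem_inter_iff]
    rw [e]
    refine (measurableSet_le measurable_const measurable_fst).inter (measurableSet_le ?_ measurable_const)
    exact ((((measurable_pi_apply 0).comp measurable_snd).pow_const 2).add
      (((measurable_pi_apply 1).comp measurable_snd).pow_const 2)).add (measurable_fst.pow_const 2)
  have hslice : ∀ τ : ℝ, volume (Prod.mk τ ⁻¹' S) = (Set.Icc t ρ).indicator (fun τ => ENNReal.ofReal ((ρ ^ 2 - τ ^ 2) * Real.pi)) τ := by
    intro τ
    by_cases hτ : τ ∈ Set.Icc t ρ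
    · rw [Set.indicator_of_mem hτ]
      have hτ2 : τ ^ 2 ≤ ρ ^ 2 := sq_le_sq' (ht.trans hτ.1) hτ.2
      have e : Prod.mk τ ⁻¹' S = {p : Fin 2 → ℝ | p 0 ^ 2 + p 1 ^ 2 ≤ Real.sqrt (ρ ^ 2 - τ ^ 2) ^ 2} := by
        ext p
        simp only [hSdef, Set.mem_preimage, Set.mem_setOf_eq, Real.sq_sqrt (sub_nonneg.2 hτ2)]
        constructor
        · rintro ⟨-, h⟩; linarith
        · intro h; exact ⟨hτ.1, by linarith⟩
      rw [e, volume_coordDisc (Real.sqrt_nonneg _), ← ENNReal.ofReal_pow (Real.sqrt_nonneg _), Real.sq_sqrt (sub_nonneg.2 hτ2),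
        ← ENNReal.ofReal_mul (sub_nonneg.2 hτ2)]
    · rw [Set.indicator_of_notMem hτ]
      have e : Prod.mk τ ⁻¹' S = ∅ := by
        ext p
        simp only [hSdef, Set.mem_preimage, Set.mem_setOf_eq, Set.mem_empty_iff_false, iff_false, not_and]
        intro h1 h2
        apply hτ
        refine ⟨h1, ?_⟩
        have h3 : τ ^ 2 ≤ ρ ^ 2 := by nlinarith [sq_nonneg (p 0), sq_nonneg (p 1)]
        exact (abs_le_of_sq_le_sq' h3 hρ).2
      rw [e, measure_empty]
  rw [show (volume : Measure (ℝ × (Fin 2 → ℝ))) = (volume : Measure ℝ).prod volume from rfl, Measure.prod_apply hSm]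
  simp_rw [hslice]
  have hcont : Continuous fun τ : ℝ => (ρ ^ 2 - τ ^ 2) * Real.pi := by fun_prop
  have hnn : ∀ τ ∈ Set.Icc t ρ, 0 ≤ (ρ ^ 2 - τ ^ 2) * Real.pi := fun τ hτ =>
    mul_nonneg (sub_nonneg.2 (sq_le_sq' (ht.trans hτ.1) hτ.2)) Real.pi_pos.le
  rw [lintegral_indicator measurableSet_Icc,
    ← ofReal_integral_eq_lintegral_ofReal hcont.integrableOn_Icc (ae_restrict_of_forall_mem measurableSet_Icc hnn),
    integral_Icc_eq_integral_Ioc, ← intervalIntegral.integral_of_le htρ, integral_cap_profile]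

/-- ★★ THE EXACT CAP VOLUME: `volume (orthoCap b c t ρ) = capVol ρ t = (π/3)(ρ − t)²(2ρ + t)` for `−ρ ≤ t ≤ ρ`, any orthonormal basis, any centre. -/
theorem volume_orthoCap_eq (b : OrthonormalBasis (Fin 3) ℝ E3) (c : E3) {t ρ : ℝ} (ht : -ρ ≤ t) (htρ : t ≤ ρ) :
    volume (orthoCap b c t ρ) = ENNReal.ofReal (capVol ρ t) := by
  have hρ : 0 ≤ ρ := by linarith
  have hT : MeasurePreserving (fun x : E3 => b.repr (x - c)) volume volume :=
    b.measurePreserving_repr.comp (measurePreserving_sub_right volume c)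
  -- coordinate sets
  set S := {z : ℝ × (Fin 2 → ℝ) | t ≤ z.1 ∧ z.2 0 ^ 2 + z.2 1 ^ 2 + z.1 ^ 2 ≤ ρ ^ 2} with hSdef
  set S' : Set (Fin 3 → ℝ) := {f | t ≤ f 2 ∧ f 0 ^ 2 + f 1 ^ 2 + f 2 ^ 2 ≤ ρ ^ 2} with hS'
  have hsplit : S' = (MeasurableEquiv.piFinSuccAbove (fun _ => ℝ) 2) ⁻¹' S := by
    ext f
    simp only [hS', hSdef, Set.mem_setOf_eq, Set.mem_preimage]
    have e0 : (2 : Fin 3).succAbove 0 = 0 := by decide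
    have e1 : (2 : Fin 3).succAbove 1 = 1 := by decide
    show _ ↔ t ≤ f 2 ∧ f ((2 : Fin 3).succAbove 0) ^ 2 + f ((2 : Fin 3).succAbove 1) ^ 2 + f 2 ^ 2 ≤ ρ ^ 2
    rw [e0, e1]
  have hSm : MeasurableSet S := by
    have e : S = {z : ℝ × (Fin 2 → ℝ) | t ≤ z.1} ∩ {z | z.2 0 ^ 2 + z.2 1 ^ 2 + z.1 ^ 2 ≤ ρ ^ 2} := by
      ext z; simp only [hSdef, Set.mem_setOf_eq, Set.mem_inter_iff]
    rw [e]
    refine (measurableSet_le measurable_const measurable_fst).inter (measurableSet_le ?_ measurable_const)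
    exact ((((measurable_pi_apply 0).comp measurable_snd).pow_const 2).add
      (((measurable_pi_apply 1).comp measurable_snd).pow_const 2)).add (measurable_fst.pow_const 2)
  have hS'm : MeasurableSet S' := by rw [hsplit]; exact hSm.preimage (MeasurableEquiv.measurable _)
  have hS'vol : volume S' = ENNReal.ofReal (capVol ρ t) := by
    rw [hsplit, (volume_preserving_piFinSuccAbove (fun _ : Fin 3 => ℝ) 2).measure_preimage hSm.nullMeasurableSet, volume_capCoord ht htρ]
  -- the cap is the preimage of `ofLp ⁻¹' S'` under the coordinate map
  have hset : orthoCap b c t ρ = (fun x : E3 => b.repr (x - c)) ⁻¹' ((WithLp.ofLp : E3 → (Fin 3 → ℝ)) ⁻¹' S') := by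
    ext x
    simp only [orthoCap, hS', Set.mem_setOf_eq, Set.mem_preimage, b.repr_apply_apply]
    have hpar : ⟪b 0, x - c⟫ ^ 2 + ⟪b 1, x - c⟫ ^ 2 + ⟪b 2, x - c⟫ ^ 2 = ‖x - c‖ ^ 2 := by
      rw [← b.sum_sq_inner_right (x - c), Fin.sum_univ_three]
    rw [hpar, dist_eq_norm, pow_le_pow_iff_left₀ (norm_nonneg _) hρ two_ne_zero]
  have hmeas : MeasurableSet ((WithLp.ofLp : E3 → (Fin 3 → ℝ)) ⁻¹' S') := hS'm.preimage (PiLp.volume_preserving_ofLp (Fin 3)).measurable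
  rw [hset, hT.measure_preimage hmeas.nullMeasurableSet, (PiLp.volume_preserving_ofLp (Fin 3)).measure_preimage hS'm.nullMeasurableSet, hS'vol]

/-- The cap is a closed, hence measurable, set. -/
theorem measurableSet_orthoCap (b : OrthonormalBasis (Fin 3) ℝ E3) (c : E3) (t ρ : ℝ) : MeasurableSet (orthoCap b c t ρ) := by
  have e : orthoCap b c t ρ = {x : E3 | t ≤ ⟪b 2, x - c⟫} ∩ Metric.closedBall c ρ := by
    ext x; simp only [orthoCap, Set.mem_setOf_eq, Set.mem_inter_iff, Metric.mem_closedBall]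
  rw [e]
  refine (IsClosed.measurableSet ?_).inter Metric.isClosed_closedBall.measurableSet
  exact isClosed_le continuous_const (by fun_prop)

/-- LENS GEOMETRY: with `0 < L = dist x₀ c`, axis `b 2 = L⁻¹ • (c − x₀)`, plane level `t = (ϱ'² − L² − A'²)/(2L)` and `−A' ≤ t`, the cap of `B̄(x₀, ϱ')`
above the plane (`t + L ≤ ⟪b 2, · − x₀⟫`) lies inside the cap of `B̄(c, A')` above it. -/
theorem innerCap_subset_cap {b : OrthonormalBasis (Fin 3) ℝ E3} {x₀ c : E3} {A' ϱ' t : ℝ} (hL : 0 < dist x₀ c)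
    (hb : b 2 = (dist x₀ c)⁻¹ • (c - x₀)) (ht : t = (ϱ' ^ 2 - dist x₀ c ^ 2 - A' ^ 2) / (2 * dist x₀ c)) (h1 : -A' ≤ t) (h2 : t ≤ A') :
    orthoCap b x₀ (t + dist x₀ c) ϱ' ⊆ orthoCap b c t A' := by
  set L := dist x₀ c with hLdef
  have hA' : 0 ≤ A' := by linarith
  have htL : 2 * L * t = ϱ' ^ 2 - L ^ 2 - A' ^ 2 := by
    rw [ht]; field_simp
  have hLn : ‖c - x₀‖ = L := by rw [hLdef, dist_eq_norm']
  have hn2 : ⟪b 2, c - x₀⟫ = L := by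
    rw [hb, real_inner_smul_left, real_inner_self_eq_norm_sq, hLn]
    field_simp
  rintro x ⟨hx1, hx2⟩
  have hsplit : x - c = (x - x₀) - (c - x₀) := by abel
  refine ⟨?_, ?_⟩
  · rw [hsplit, inner_sub_right, hn2]; linarith
  · have hax : ⟪x - x₀, c - x₀⟫ = L * ⟪b 2, x - x₀⟫ := by
      rw [hb, real_inner_smul_left, real_inner_comm]; field_simp
    have hexp : dist x c ^ 2 = dist x x₀ ^ 2 - 2 * (L * ⟪b 2, x - x₀⟫) + L ^ 2 := by
      rw [dist_eq_norm, dist_eq_norm, hsplit, norm_sub_sq_real, hax, hLn]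
    have hd2 : dist x x₀ ^ 2 ≤ ϱ' ^ 2 := pow_le_pow_left₀ dist_nonneg hx2 2
    have hsq : dist x c ^ 2 ≤ A' ^ 2 := by nlinarith
    exact (abs_le_of_sq_le_sq' hsq hA').2

/-- ★★ THE CORED CAP (exact lens geometry): member `c` with `0 < L = dist x₀ c`, axis `b 2 = L⁻¹ • (c − x₀)`, radii `A', ϱ'` and the plane level
`t = (ϱ'² − L² − A'²)/(2L)` (so that `S(x₀, ϱ') ∩ S(c, A')` lies in the plane `axial = t`), with `−A' ≤ t ≤ A'`, `−ϱ' ≤ t + L ≤ ϱ'`: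
`volume (orthoCap b c t A' ∩ {ϱ' ≤ dist · x₀}) ≤ capVol A' t − capVol ϱ' (t + L)` — the cap of `B̄(x₀, ϱ')` above the plane sits inside the cap of
`B̄(c, A')` and misses the cored part; its bounding sphere is Lebesgue-null (`Measure.addHaar_sphere`). -/
theorem volume_coredCap_le {b : OrthonormalBasis (Fin 3) ℝ E3} {x₀ c : E3} {A' ϱ' t : ℝ} (hL : 0 < dist x₀ c)
    (hb : b 2 = (dist x₀ c)⁻¹ • (c - x₀)) (ht : t = (ϱ' ^ 2 - dist x₀ c ^ 2 - A' ^ 2) / (2 * dist x₀ c))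
    (h1 : -A' ≤ t) (h2 : t ≤ A') (h3 : -ϱ' ≤ t + dist x₀ c) (h4 : t + dist x₀ c ≤ ϱ') :
    volume (orthoCap b c t A' ∩ {x | ϱ' ≤ dist x x₀}) ≤ ENNReal.ofReal (capVol A' t) - ENNReal.ofReal (capVol ϱ' (t + dist x₀ c)) := by
  set L := dist x₀ c with hLdef
  -- C₂ := cap of B̄(x₀, ϱ') above the plane, minus the null sphere
  set C₂ : Set E3 := orthoCap b x₀ (t + L) ϱ' \ Metric.sphere x₀ ϱ' with hC₂
  have hC₂sub : C₂ ⊆ orthoCap b c t A' := Set.sdiff_subset.trans (innerCap_subset_cap hL hb ht h1 h2)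
  have hdisj : Disjoint (orthoCap b c t A' ∩ {x | ϱ' ≤ dist x x₀}) C₂ := by
    rw [Set.disjoint_left]
    rintro x ⟨-, hx⟩ ⟨⟨-, hx2⟩, hx3⟩
    apply hx3
    rw [Metric.mem_sphere]
    exact le_antisymm hx2 hx
  have hC₂m : MeasurableSet C₂ := (measurableSet_orthoCap b x₀ (t + L) ϱ').diff Metric.isClosed_sphere.measurableSet
  have hC₂vol : volume C₂ = ENNReal.ofReal (capVol ϱ' (t + L)) := by
    rw [hC₂, measure_sdiff_null (Measure.addHaar_sphere volume x₀ ϱ'), volume_orthoCap_eq b x₀ h3 h4]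
  have hsum : volume (orthoCap b c t A' ∩ {x | ϱ' ≤ dist x x₀}) + volume C₂ ≤ ENNReal.ofReal (capVol A' t) := by
    rw [← measure_union hdisj hC₂m, ← volume_orthoCap_eq b c h1 h2]
    exact measure_mono (Set.union_subset Set.inter_subset_left hC₂sub)
  rw [hC₂vol] at hsum
  exact ENNReal.le_sub_of_add_le_right ENNReal.ofReal_ne_top hsum

/-- ★★ THE EXACT CORED SOURCE COUNT: window `(a,h)`, `g` isometry, member `c` with `0 < L = dist x₀ c`, axis basis `b 2 = L⁻¹ • (c − x₀)`, `9/5 ≤ ϱ`;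
finite `T ⊆ g '' barlowStacking a h s` with `dist y c ≤ A`, `ϱ ≤ dist y x₀` on `T`; `A' = A + 9/5`, `ϱ' = ϱ − 9/5`, `t = (ϱ'² − L² − A'²)/(2L)` with
`−A' ≤ t ≤ A'`, `−ϱ' ≤ t + L ≤ ϱ'` ⟹ `#T · a(a√3/2)h ≤ capVol A' t − capVol ϱ' (t + L)` (= the exact volume of `B̄(c, A') ∖ B(x₀, ϱ')`). -/
theorem card_mul_le_capDiff_of_cored {a h : ℝ} {s : ℤ → ℤ} {g : E3 → E3}
    (ha : 9 / 10 ≤ a ∧ a ≤ 11 / 10) (hh : 0 < h ∧ 27 / 50 * a ^ 2 ≤ h ^ 2 ∧ h ^ 2 ≤ 121 / 150 * a ^ 2) (hg : Isometry g)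
    {b : OrthonormalBasis (Fin 3) ℝ E3} {x₀ c : E3} {A ϱ t : ℝ} (hL : 0 < dist x₀ c) (hb : b 2 = (dist x₀ c)⁻¹ • (c - x₀)) (hϱ : 9 / 5 ≤ ϱ)
    (T : Finset E3) (hT : ↑T ⊆ g '' barlowStacking a h s) (hTA : ∀ y ∈ T, dist y c ≤ A) (hTϱ : ∀ y ∈ T, ϱ ≤ dist y x₀)
    (ht : t = ((ϱ - 9 / 5) ^ 2 - dist x₀ c ^ 2 - (A + 9 / 5) ^ 2) / (2 * dist x₀ c))
    (h1 : -(A + 9 / 5) ≤ t) (h2 : t ≤ A + 9 / 5) (h3 : -(ϱ - 9 / 5) ≤ t + dist x₀ c) (h4 : t + dist x₀ c ≤ ϱ - 9 / 5) :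
    (T.card : ℝ) * (a * (a * √3 / 2) * h) ≤ capVol (A + 9 / 5) t - capVol (ϱ - 9 / 5) (t + dist x₀ c) := by
  have ha0 : 0 ≤ a := by linarith [ha.1]
  have hV0 : 0 ≤ a * (a * √3 / 2) * h := by have := hh.1.le; positivity
  set K : Set E3 := {z | dist z c ≤ A ∧ ϱ ≤ dist z x₀} with hK
  have hT' : ↑T ⊆ g '' barlowStacking a h s ∩ K := fun y hy => ⟨hT hy, hTA y (Finset.mem_coe.1 hy), hTϱ y (Finset.mem_coe.1 hy)⟩
  have c1 := card_mul_le_volume_near_of_subset_image ha hh hg K T hT'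
  have c2 : {x : E3 | ∃ z ∈ K, dist x z ≤ 9 / 5} ⊆ orthoCap b c t (A + 9 / 5) ∩ {x | ϱ - 9 / 5 ≤ dist x x₀} := by
    rintro x ⟨z, hz, hxz⟩
    refine ⟨?_, ?_⟩
    · rw [ht]; exact near_cored_subset_cap hL hb hϱ ⟨z, hz, hxz⟩
    · have := dist_triangle z x x₀
      rw [dist_comm z x] at this
      show ϱ - 9 / 5 ≤ dist x x₀
      linarith [hz.2]
  have c3 := (c1.trans (measure_mono c2)).trans (volume_coredCap_le hL hb ht h1 h2 h3 h4)
  have hnn2 : 0 ≤ capVol (ϱ - 9 / 5) (t + dist x₀ c) := capVol_nonneg (by linarith)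
  have hnn1 : 0 ≤ capVol (A + 9 / 5) t := capVol_nonneg (by linarith)
  -- capVol ϱ' (t+L) ≤ capVol A' t : the inner cap sits inside the outer cap
  have hle : capVol (ϱ - 9 / 5) (t + dist x₀ c) ≤ capVol (A + 9 / 5) t := by
    have hv := measure_mono (μ := volume) (innerCap_subset_cap hL hb ht h1 h2)
    rw [volume_orthoCap_eq b x₀ h3 h4, volume_orthoCap_eq b c h1 h2, ENNReal.ofReal_le_ofReal_iff hnn1] at hv
    exact hv
  rw [← ENNReal.ofReal_sub _ hnn2, ← ENNReal.ofReal_natCast, ← ENNReal.ofReal_mul (Nat.cast_nonneg _),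
    ENNReal.ofReal_le_ofReal_iff (sub_nonneg.2 hle)] at c3
  exact c3

end CapCount

end Summit.AtomisticToContinuum.Crystallization.Theorems.ChargedEnergyGapChartDial

end
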